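import Summits.QuantumFields.YangMills.Theses.SteinGapBootstrap
import Summits.QuantumFields.YangMills.Theorems.EntropyBudgetEquipartitionFreeEnergyRate
import Summits.QuantumFields.YangMills.Theorems.EntropyBudgetEquipartitionBudgetRate
import Summits.QuantumFields.YangMills.Theorems.SteinGapBootstrapAxisSymmetryG
import Summits.QuantumFields.YangMills.Theorems.EquipartitionCriticalityEquipartitionPinsProbeTangentDefs
import Summits.QuantumFields.YangMills.Theorems.EquipartitionCriticalityEquipartitionPinsProbeTangentPlaquetteEnergy
import Literature.MathematicalPhysics.QuantumFieldTheory.WilsonAxisSymmetry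
import HarnessLib

/-!
# Crux U `FreeProbeLawG` (stmt-QuantumFields-23756), line `birth`, STUB `stub_budgetRate` — sharp equipartition at rate

Route `SteinGapBootstrap` of `QuantumFields/YangMills` (lead `ym-line-sgb-k1-g1`). HONEST LABEL: the route serves the RECORD-label
rung R2ξ-G (`WeakCouplingRates.XiPow`, an UPPER bound on the lattice gap); nothing here bears on the Yang–Mills mass gap itself.

The registered stub `stub_budgetRate` of the lead's reshaped skeleton (`Cruxes/FreeProbeLawG/Lines/birth.lean`): for every compact
simple `G` and faithful unitary lattice representation `r` there are `κ > 0`, `C`, `β₀` with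

  `|β · ∫ (N − Re tr r(U_{(x;i,j)})) dμ − D/4| ≤ C β^(−κ)`

for every `β ≥ β₀`, every torus-limit state `μ ∈ infiniteVolumeLimitPoints r.ρ β` (`d = 4`) and every plaquette `(x; i, j)`,
`i ≠ j` (`D = lieDim r = dim_ℝ 𝔤_r`). This is input (a) «quantitative free energy ⇒ sharp equipartition» of the child C1ᶠ
`PairSteinDiscrepancyFreeG`, now a theorem: the free-energy RATE is the CLOSED crux `EntropyBudgetEquipartition.FreeEnergyRate`
(`freeEnergyRate_proof`, Chatterjee's Thm 2.1 with a power rate), Griffiths' lemma with the quantitative subgradient squeeze gives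
`|β E_μ[s₀] − 3D/2| ≤ C′ β^(−κ/2)` for the origin site energy `s₀ = ∑_{i<j}` (`BudgetRate.budgetRate_limitStates`), and the twelve
oriented plaquettes at the origin have the same mean under a limit state (axis permutations:
`integral_comp_configPermZd_of_mem_limitPoints`, `plaquetteObs_configPermZd`; orientation: `plaquetteObs_swap`), so each carries
`D/4`; a general base point is moved to the origin by B-TI (`integral_comp_configShift_of_mem_limitPoints`).

References: S. Chatterjee, arXiv:1602.01222, Thm 2.1 [arXiv160201222]; R. B. Griffiths, J. Math. Phys. 5 (1964) 1215;
S. Friedli–Y. Velenik, CUP 2017, Thm 3.34 [FriedliVelenik2017]; E. Seiler, LNP 159 (1982) Ch. 2 [SeilerLNP1982].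
-/

set_option autoImplicit false

noncomputable section

open MeasureTheory Filter
open Literature.MathematicalPhysics.QuantumLattice Literature.MathematicalPhysics.QuantumFieldTheory
open Summit.QuantumFields.YangMills.Theorems
open Summit.QuantumFields.YangMills.Theorems.EquipartitionPinsProbe
open Summit.QuantumFields.YangMills.Theorems.WeakCouplingRates

namespace Summit.QuantumFields.YangMills.Cruxes.FreeProbeLawG.SteinFree

section Symmetry

variable {G : Type} [Group G] [TopologicalSpace G] [IsTopologicalGroup G] [CompactSpace G]
  [MeasurableSpace G] [BorelSpace G]

/-- Under a torus-limit state all oriented plaquettes at the origin have the same mean energy as the `(0,1)` plaquette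
(axis-permutation invariance of limit states). -/
theorem integral_plaquetteCost_origin_eq {N : ℕ} (ρ : G →* Matrix (Fin N) (Fin N) ℂ) (hρ : Continuous ρ)
    (hρu : ∀ g, ρ g ∈ Matrix.unitaryGroup (Fin N) ℂ) {β : ℝ} {μ : Measure (LGConfig 4 G)}
    (hμ : μ ∈ infiniteVolumeLimitPoints (d := 4) ρ β) {i j : Fin 4} (hij : i ≠ j) :
    ∫ U, ((N : ℝ) - plaquetteObs ρ 0 i j U) ∂μ = ∫ U, ((N : ℝ) - plaquetteObs ρ 0 0 1 U) ∂μ := by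
  -- an axis permutation `π` with `π 0 = i`, `π 1 = j` (cf. `FemtoCurvatureTwoPoint.exists_perm_apply_zero_one`)
  obtain ⟨π, hπ0, hπ1⟩ : ∃ π : Equiv.Perm (Fin 4), π 0 = i ∧ π 1 = j := by
    classical
    have hj'0 : Equiv.swap (0 : Fin 4) i j ≠ 0 := by
      intro h
      have : Equiv.swap (0 : Fin 4) i j = Equiv.swap (0 : Fin 4) i i := by rw [h, Equiv.swap_apply_right]
      exact hij ((Equiv.swap (0 : Fin 4) i).injective this).symm
    refine ⟨(Equiv.swap (1 : Fin 4) (Equiv.swap (0 : Fin 4) i j)).trans (Equiv.swap (0 : Fin 4) i), ?_, ?_⟩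
    · rw [Equiv.trans_apply, Equiv.swap_apply_of_ne_of_ne (by decide) (Ne.symm hj'0), Equiv.swap_apply_left]
    · rw [Equiv.trans_apply, Equiv.swap_apply_left, Equiv.swap_apply_self]
  have hcyl : IsCylinder (fun U : LGConfig 4 G => (N : ℝ) - plaquetteObs ρ 0 i j U) (originPlaquetteSupport i j) :=
    fun U V h => congrArg (fun y : ℝ => (N : ℝ) - y) (isCylinder_plaquetteObs_zero ρ i j h)
  have h := SteinGapBootstrap.integral_comp_configPermZd_of_mem_limitPoints ρ hρ hμ π hcyl
    (continuous_const.sub (continuous_plaquetteObs ρ hρ 0 i j))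
    ⟨2 * N, fun U => TangentPlaquetteEnergy.abs_sub_plaquetteObs_le ρ hρu 0 i j U⟩
  rw [← h]
  refine integral_congr_ae (ae_of_all _ fun U => ?_)
  have hi : π.symm i = 0 := by rw [Equiv.symm_apply_eq]; exact hπ0.symm
  have hj : π.symm j = 1 := by rw [Equiv.symm_apply_eq]; exact hπ1.symm
  simp only [plaquetteObs_configPermZd, sitePermZd_zero, hi, hj]

end Symmetry

/-- **STUB `stub_budgetRate` of line `birth`** (crux U `FreeProbeLawG`, stmt-QuantumFields-23756): sharp equipartition at a power
rate, per plaquette, for every torus-limit state of the 4-D Wilson theory — `|β · ∫(N − Re tr r(U_{(x;i,j)})) dμ − D/4| ≤ C β^(−κ)`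
for `β ≥ β₀`, `μ ∈ infiniteVolumeLimitPoints r.ρ β`, `i ≠ j` (`D = lieDim r`). From the CLOSED free-energy rate
(`freeEnergyRate_proof`) through `budgetRate_limitStates`, axis/orientation symmetry and B-TI of limit states.
[cite: arXiv160201222, Thm 2.1] [cite: FriedliVelenik2017, Thm 3.34] -/
theorem stub_budgetRate :
    ∀ (G : Type) [Group G] [TopologicalSpace G] [IsTopologicalGroup G] [CompactSpace G]
      [MeasurableSpace G] [BorelSpace G],
      Literature.MathematicalPhysics.QuantumFieldTheory.IsCompactSimpleLieGroup G →
      ∀ r : Literature.MathematicalPhysics.QuantumFieldTheory.LatticeRep G,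
        ∃ κ C β₀ : ℝ, 0 < κ ∧ ∀ β : ℝ, β₀ ≤ β →
          ∀ μ ∈ Literature.MathematicalPhysics.QuantumLattice.infiniteVolumeLimitPoints (d := 4) r.ρ β,
            ∀ (x : Literature.Probability.LatticeModels.Site 4) (i j : Fin 4), i ≠ j →
              |β * (∫ U, ((r.N : ℝ) - Literature.MathematicalPhysics.QuantumLattice.plaquetteObs r.ρ x i j U) ∂μ) -
                  (Summit.QuantumFields.YangMills.Theorems.EquipartitionPinsProbe.lieDim r : ℝ) / 4| ≤ C * β ^ (-κ) := by
  intro G _ _ _ _ instM _ hG r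
  -- reduce to the Borel σ-algebra `borel G` (the free-energy rate is stated for it)
  obtain rfl : instM = borel G := BorelSpace.measurable_eq
  letI : MeasurableSpace G := borel G
  haveI : SecondCountableTopology G :=
    (r.continuous.isClosedEmbedding r.injective).isEmbedding.secondCountableTopology
  -- the free-energy RATE (closed crux `FreeEnergyRate` of route `EntropyBudgetEquipartition`)
  obtain ⟨K, κ, C, β₀, hκ, hrate⟩ := freeEnergyRate_proof G hG r
  -- budget rate for the origin site energy of limit states
  obtain ⟨C', β₁, H⟩ := EntropyBudgetEquipartition.BudgetRate.budgetRate_limitStates r (D := lieDim r) hκ hrate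
  refine ⟨κ / 2, C' / 6, β₁, half_pos hκ, fun β hβ μ hμ x i j hij => ?_⟩
  haveI : IsProbabilityMeasure μ := by obtain ⟨_, _, hprob, _⟩ := hμ; exact hprob
  have hsite := H β hβ μ hμ
  -- every summand of the site energy has the mean `e` of the `(0,1)` plaquette
  set e : ℝ := ∫ U, ((r.N : ℝ) - plaquetteObs r.ρ 0 0 1 U) ∂μ with he
  have hsum : ∫ U, (∑ i : Fin 4, ∑ j : Fin 4,
      if i < j then ((r.N : ℝ) - plaquetteObs r.ρ 0 i j U) else 0) ∂μ = 6 * e := by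
    have hint : ∀ i j : Fin 4, Integrable (fun U : LGConfig 4 G =>
        if i < j then ((r.N : ℝ) - plaquetteObs r.ρ 0 i j U) else 0) μ := by
      intro i j
      by_cases h : i < j
      · simp only [h, if_true]
        exact TangentPlaquetteEnergy.integrable_sub_plaquetteObs r.ρ r.continuous r.mem_unitary μ 0 i j
      · simp only [h, if_false]
        exact integrable_const _
    rw [integral_finsetSum _ fun i _ => integrable_finsetSum _ fun j _ => hint i j]
    have hterm : ∀ i j : Fin 4, ∫ U, (if i < j then ((r.N : ℝ) - plaquetteObs r.ρ 0 i j U) else 0) ∂μ =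
        if i < j then e else 0 := by
      intro i j
      by_cases h : i < j
      · simp only [h, if_true]
        exact integral_plaquetteCost_origin_eq r.ρ r.continuous r.mem_unitary hμ (ne_of_lt h)
      · simp only [h, if_false, integral_zero]
    simp_rw [integral_finsetSum _ fun j _ => hint _ j, hterm]
    simp only [Fin.sum_univ_four]
    norm_num [Fin.lt_def]
    ring
  -- the plaquette `(x; i, j)` has mean `e`: B-TI to the origin, then axis symmetry
  have hx : ∫ U, ((r.N : ℝ) - plaquetteObs r.ρ x i j U) ∂μ = e := by
    have hcyl : IsCylinder (fun U : LGConfig 4 G => (r.N : ℝ) - plaquetteObs r.ρ 0 i j U)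
        (originPlaquetteSupport i j) := fun U V h =>
      congrArg (fun y : ℝ => (r.N : ℝ) - y) (isCylinder_plaquetteObs_zero r.ρ i j h)
    have h := integral_comp_configShift_of_mem_limitPoints r.ρ hμ (-x) hcyl
      (continuous_const.sub (continuous_plaquetteObs r.ρ r.continuous 0 i j))
      ⟨2 * r.N, fun U => TangentPlaquetteEnergy.abs_sub_plaquetteObs_le r.ρ r.mem_unitary 0 i j U⟩
    have h' : ∫ U, ((r.N : ℝ) - plaquetteObs r.ρ x i j U) ∂μ = ∫ U, ((r.N : ℝ) - plaquetteObs r.ρ 0 i j U) ∂μ := by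
      rw [← h]
      refine integral_congr_ae (ae_of_all _ fun U => ?_)
      simp only [TangentPlaquetteEnergy.plaquetteObs_configShift, zero_sub, neg_neg]
    rw [h', he]
    exact integral_plaquetteCost_origin_eq r.ρ r.continuous r.mem_unitary hμ hij
  rw [hx]
  rw [hsum] at hsite
  -- `|β·6e − 3D/2| ≤ C' β^(−κ/2)` ⇒ `|β e − D/4| ≤ (C'/6) β^(−κ/2)`
  have h6 : β * e - (lieDim r : ℝ) / 4 = (β * (6 * e) - 3 * (lieDim r : ℝ) / 2) / 6 := by ring
  rw [h6, abs_div, abs_of_pos (by norm_num : (0 : ℝ) < 6), div_le_iff₀ (by norm_num : (0 : ℝ) < 6)]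
  calc |β * (6 * e) - 3 * (lieDim r : ℝ) / 2| ≤ C' * β ^ (-(κ / 2)) := hsite
    _ = C' / 6 * β ^ (-(κ / 2)) * 6 := by ring

end Summit.QuantumFields.YangMills.Cruxes.FreeProbeLawG.SteinFree

end
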